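import Mathlib
import Summits.CriticalPhenomena.CardyFormulaZ2.Theorems.CardyFlipRussoSquareFromVoronoiHubDefs
import Summits.CriticalPhenomena.CardyFormulaZ2.Theorems.CardyFlipRussoSquareFromVoronoiHubFaithfulPart2
import Summits.CriticalPhenomena.CardyFormulaZ2.Theorems.CardyFlipRussoSquareFromVoronoiHubFaithfulPart4
import Summits.CriticalPhenomena.CardyFormulaZ2.Theorems.CardyFlipRussoSquareFromVoronoiHubFaithfulPart5
import Summits.CriticalPhenomena.CardyFormulaZ2.Theorems.CardyFlipRussoSquareFromVoronoiHubFaithfulPart7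

/-!
# Stub `stub_faithful` (K1), line `Sketch` of crux `SquareFromVoronoiHub` — Part 6:
# robustly black paths started in an exterior cap give the crude block crossing

Crux `Summit.CriticalPhenomena.CardyFormulaZ2.Theses.CardyFlipRusso.SquareFromVoronoiHub`
(stmt-CriticalPhenomena-6434), line `Sketch` (card `voronoi-blocks-on-fixed-gs`), stub
`stub_faithful` (K1); registered sub-goals `stub_faithful_part2` and `stub_faithful_part6`.  THE
BOUNDARY LAYER: with Part 7's last exit from the collar and Part 2's lattice shadow,
`blockConfig_mem_crudeCrossing_of_robust_path` / `…_of_path` (a ROBUSTLY black path — all sites of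
`δ • G_s` within `δ/2` of it black — from within `δ` of `(ab)` to within `δ` of `(cd)`, at distance
`> δ` from `(bc)`, `(da)`, unable to make that passage off `closure Ω`, gives the crude block
crossing with the crux's `2δ` slack = `δ` collar + `δ/2` covering radius, for EVERY conformal
rectangle); and the assembly of Parts 2, 4, 5 for
the design of the lower sandwich rectangle `R₁` of Part 3 (exterior caps beyond `(ab)`, `(cd)`,
marked points on the outer cap boundaries away from `closure Ω`, so that the skeleton path through
the in-discs and shared-edge midpoints of the black cells of a crossing of `R₁` starts deep in the
exterior cap beyond `(ab)`): `blockConfig_mem_crudeCrossing_of_split_path` — a ROBUSTLY black path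
(all sites of `δ • G_s` within `δ/2` of it black) started within `δ` of `(ab)` OR off `closure Ω`
inside the `(ab)`-side piece `F₀` of a splitting, coming within `δ` of `(cd)`, at distance `> δ`
from `(bc)`, `(da)`, gives `blockConfig δ s c ∈ crudeCrossing R δ`, for EVERY conformal rectangle
(truncate at the first entry through `(ab)`, Part 5; apply the robust-path lemma with `hcl` from
Part 4's splitting lemma).
-/

noncomputable section

namespace Summit.CriticalPhenomena.CardyFormulaZ2.Cruxes.SquareFromVoronoiHub.VoronoiBlocks.Faithful

open scoped Pointwise Topology
open Set Metric Filter
open Literature.Probability.Percolation (SiteConfig blackRegion)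
open Literature.Probability.RandomPlanarGeometry (ConformalRectangle)
open Literature.Analysis.FunctionSpaces (PointConfig)

/-! ### The boundary layer: robustly black paths give the crude crossing -/

/-- **Robustly black path ⇒ crude block crossing** (deterministic boundary-layer lemma of stub
K1, general form).  At mesh `δ` and cell scale `s`: a continuous path `γ` from within `δ` of the
arc `(ab)` to within `δ` of the arc `(cd)`, at distance `> δ` from the arcs `(bc)`, `(da)` (`δ` so
small that nothing is within `δ` of both `(ab)` and `(cd)`), which cannot pass from within `δ` of
`(ab)` to within `δ` of `(cd)` while avoiding `closure Ω`, and such that every site of `δ • G_s`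
within `δ/2` of `γ` lies in the black region of the nuclei dilated by `s`, puts the block
colouring `blockConfig δ s c` in the crude event `crudeCrossing R δ`: the last-exit sub-path of
`exists_collar_exit` runs `≥ δ` inside `Ω`, so its `δ/2`-neighbouring sites are in `Ω`
(`mem_of_dist_lt_infDist_frontier`) and `mem_crudeCrossing_of_isPreconnected` applies with
endpoints within `δ + δ/2 ≤ 2δ` of the arcs.  This is the form for paths through the INTERIOR of
a black cluster (a fat tube of cells need not stay in `closure Ω` near a wild `∂Ω`); no
regularity of `∂Ω` is needed. [folklore] -/
theorem blockConfig_mem_crudeCrossing_of_robust_path (R : ConformalRectangle) {δ : ℝ} (hδ : 0 < δ)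
    (s : ℝ) (c : PointConfig ℂ × PointConfig ℂ) {x y : ℂ} (γ : Path x y)
    (hx : infDist x (R.arc 0) ≤ δ) (hy : ∃ t, infDist (γ t) (R.arc 2) ≤ δ)
    (hcl : ∀ s t : unitInterval, s ≤ t → infDist (γ s) (R.arc 0) ≤ δ →
      infDist (γ t) (R.arc 2) ≤ δ → ∃ u : unitInterval, s ≤ u ∧ u ≤ t ∧ γ u ∈ closure R.carrier)
    (h1 : ∀ t, δ < infDist (γ t) (R.arc 1)) (h3 : ∀ t, δ < infDist (γ t) (R.arc 3))
    (h02 : ∀ z, infDist z (R.arc 0) ≤ δ → δ < infDist z (R.arc 2))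
    (hblack : ∀ t, ∀ v : (ℤ × ℤ) ⊕ (ℤ × ℤ), dist (γ t) ((δ : ℂ) * zGs v) ≤ δ / 2 →
      (δ : ℂ) * zGs v ∈ blackRegion ((s : ℂ) • (c.1 : Set ℂ)) ((s : ℂ) • (c.2 : Set ℂ))) :
    blockConfig δ s c ∈ crudeCrossing R δ := by
  obtain ⟨a, b, ha0, hab, hb1, ha, hb, hin⟩ := exists_collar_exit R hδ γ hx hy hcl h1 h3 h02
  have hcont : Continuous γ.extend := γ.continuous_extend
  refine mem_crudeCrossing_of_isPreconnected R hδ (ω := blockConfig δ s c)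
    ((isPreconnected_Icc).image _ hcont.continuousOn) ((isCompact_Icc.image hcont).isBounded)
    (mem_image_of_mem _ (left_mem_Icc.2 hab.le)) (mem_image_of_mem _ (right_mem_Icc.2 hab.le))
    (ha.trans (by linarith)) (hb.trans (by linarith)) ?_
  rintro v ⟨_, ⟨t, ht, rfl⟩, htv⟩
  have ht01 : t ∈ Icc (0 : ℝ) 1 := ⟨ha0.trans ht.1, ht.2.trans hb1⟩
  obtain ⟨hmem, hfar⟩ := hin t ht
  refine ⟨?_, mem_of_dist_lt_infDist_frontier R.isOpen hmem ?_⟩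
  · show (δ : ℂ) * zGs v ∈ blackRegion ((s : ℂ) • (c.1 : Set ℂ)) ((s : ℂ) • (c.2 : Set ℂ))
    refine hblack ⟨t, ht01⟩ v ?_
    rwa [← Path.extend_apply γ ht01]
  · rw [dist_comm] at htv
    linarith

/-- **Robustly black path in `closure Ω` ⇒ crude block crossing**: the special case of
`blockConfig_mem_crudeCrossing_of_robust_path` for a path inside `closure Ω` from a point of
`(ab)` to a point of `(cd)` (e.g. the path of a continuum Voronoi crossing `voronoiCrossing`),
at distance `> δ` from `(bc)`, `(da)`, all of whose `δ/2`-neighbouring sites are black. [folklore] -/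
theorem blockConfig_mem_crudeCrossing_of_path (R : ConformalRectangle) {δ : ℝ} (hδ : 0 < δ)
    (s : ℝ) (c : PointConfig ℂ × PointConfig ℂ) {x y : ℂ} (γ : Path x y)
    (hx : x ∈ R.arc 0) (hy : y ∈ R.arc 2) (hcl : ∀ t, γ t ∈ closure R.carrier)
    (h1 : ∀ t, δ < infDist (γ t) (R.arc 1)) (h3 : ∀ t, δ < infDist (γ t) (R.arc 3))
    (h02 : ∀ z, infDist z (R.arc 0) ≤ δ → δ < infDist z (R.arc 2))
    (hblack : ∀ t, ∀ v : (ℤ × ℤ) ⊕ (ℤ × ℤ), dist (γ t) ((δ : ℂ) * zGs v) ≤ δ / 2 →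
      (δ : ℂ) * zGs v ∈ blackRegion ((s : ℂ) • (c.1 : Set ℂ)) ((s : ℂ) • (c.2 : Set ℂ))) :
    blockConfig δ s c ∈ crudeCrossing R δ := by
  refine blockConfig_mem_crudeCrossing_of_robust_path R hδ s c γ ?_ ⟨1, ?_⟩
    (fun s t hst _ _ => ⟨s, le_rfl, hst, hcl s⟩) h1 h3 h02 hblack
  · rw [infDist_zero_of_mem hx]; exact hδ.le
  · rw [γ.target, infDist_zero_of_mem hy]; exact hδ.le

/-! ### Robustly black paths started in the exterior cap -/

/-- **Robustly black path from the exterior cap ⇒ crude block crossing.**  At mesh `δ` and cell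
scale `s`, let `F₀`, `F₂` be disjoint closed sets containing every off-`closure Ω` point of the
path `γ`, `F₀` at distance `> δ` from `(cd)` and `F₂` at distance `> δ` from `(ab)` (in the
application: `o(1)`-neighbourhoods of the exterior caps of the lower sandwich rectangle).  If `γ`
starts within `δ` of `(ab)` OR off `closure Ω` inside `F₀`, comes within `δ` of `(cd)`, stays at
distance `> δ` from `(bc)`, `(da)` (`δ` so small that nothing is within `δ` of both `(ab)` and
`(cd)`), and every site of `δ • G_s` within `δ/2` of `γ` is black, then
`blockConfig δ s c ∈ crudeCrossing R δ`: truncate `γ` at its first entry through `(ab)`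
(`exists_first_entry`) and apply `blockConfig_mem_crudeCrossing_of_robust_path`, its
topological input `hcl` being Part 4's `exists_mem_closure_of_split`. [folklore] -/
theorem blockConfig_mem_crudeCrossing_of_split_path (R : ConformalRectangle) {δ : ℝ} (hδ : 0 < δ)
    (s : ℝ) (c : PointConfig ℂ × PointConfig ℂ) {x y : ℂ} (γ : Path x y)
    {F₀ F₂ : Set ℂ} (hF₀ : IsClosed F₀) (hF₂ : IsClosed F₂) (hdisj : Disjoint F₀ F₂)
    (hout : ∀ t, γ t ∉ closure R.carrier → γ t ∈ F₀ ∪ F₂)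
    (h₀ : ∀ z ∈ F₀, δ < infDist z (R.arc 2)) (h₂ : ∀ z ∈ F₂, δ < infDist z (R.arc 0))
    (hx : infDist x (R.arc 0) ≤ δ ∨ (x ∉ closure R.carrier ∧ x ∈ F₀))
    (hy : ∃ t, infDist (γ t) (R.arc 2) ≤ δ)
    (h1 : ∀ t, δ < infDist (γ t) (R.arc 1)) (h3 : ∀ t, δ < infDist (γ t) (R.arc 3))
    (h02 : ∀ z, infDist z (R.arc 0) ≤ δ → δ < infDist z (R.arc 2))
    (hblack : ∀ t, ∀ v : (ℤ × ℤ) ⊕ (ℤ × ℤ), dist (γ t) ((δ : ℂ) * zGs v) ≤ δ / 2 →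
      (δ : ℂ) * zGs v ∈ blackRegion ((s : ℂ) • (c.1 : Set ℂ)) ((s : ℂ) • (c.2 : Set ℂ))) :
    blockConfig δ s c ∈ crudeCrossing R δ := by
  rcases hx with hx | ⟨hxcl, hxF⟩
  · exact blockConfig_mem_crudeCrossing_of_robust_path R hδ s c γ hx hy
      (exists_mem_closure_of_split R γ hF₀ hF₂ hdisj hout h₀ h₂) h1 h3 h02 hblack
  · obtain ⟨t₀, ht₀0, ht₀1, harc, -, hafter⟩ :=
      exists_first_entry R hδ γ hF₀ hF₂ hdisj hout h₀ h1 h3 hxcl hxF hy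
    -- the path truncated at its first entry through `(ab)`
    set γ' := γ.truncate t₀ 1 with hγ'
    have htr : ∀ u : unitInterval, ∃ t : unitInterval, γ t = γ' u := fun u =>
      γ.truncate_range (mem_range_self u)
    refine blockConfig_mem_crudeCrossing_of_robust_path R hδ s c γ' ?_ ?_
      (exists_mem_closure_of_split R γ' hF₀ hF₂ hdisj ?_ h₀ h₂) ?_ ?_ h02 ?_
    · rw [min_eq_left ht₀1, infDist_zero_of_mem harc]; exact hδ.le
    · obtain ⟨t₂, ht₂⟩ := hy
      have ht₀t₂ : t₀ ≤ t₂ := hafter t₂ t₂.2 (by rwa [Path.extend_extends'])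
      refine ⟨t₂, ?_⟩
      have : γ' t₂ = γ t₂ := by
        show γ.extend (min (max (t₂ : ℝ) t₀) 1) = γ t₂
        rw [max_eq_left ht₀t₂, min_eq_left t₂.2.2, Path.extend_extends']
      rwa [this]
    · intro u hu
      obtain ⟨t, ht⟩ := htr u
      rw [← ht] at hu ⊢
      exact hout t hu
    · intro u; obtain ⟨t, ht⟩ := htr u; rw [← ht]; exact h1 t
    · intro u; obtain ⟨t, ht⟩ := htr u; rw [← ht]; exact h3 t
    · intro u v huv
      obtain ⟨t, ht⟩ := htr u
      rw [← ht] at huv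
      exact hblack t v huv

/-- **Registered sub-goal `stub_faithful_part6`** of `stub_faithful` (K1): robustly black path
started within `δ` of `(ab)` or off `closure Ω` in the `(ab)`-side piece of a splitting ⇒ crude
block crossing, every conformal rectangle. [folklore] -/
theorem stub_faithful_part6 : ∀ (R : ConformalRectangle) {δ : ℝ}, 0 < δ → ∀ (s : ℝ) (c : PointConfig ℂ × PointConfig ℂ) {x y : ℂ} (γ : Path x y) {F₀ F₂ : Set ℂ}, IsClosed F₀ → IsClosed F₂ → Disjoint F₀ F₂ → (∀ t, γ t ∉ closure R.carrier → γ t ∈ F₀ ∪ F₂) → (∀ z ∈ F₀, δ < Metric.infDist z (R.arc 2)) → (∀ z ∈ F₂, δ < Metric.infDist z (R.arc 0)) → (Metric.infDist x (R.arc 0) ≤ δ ∨ (x ∉ closure R.carrier ∧ x ∈ F₀)) → (∃ t, Metric.infDist (γ t) (R.arc 2) ≤ δ) → (∀ t, δ < Metric.infDist (γ t) (R.arc 1)) → (∀ t, δ < Metric.infDist (γ t) (R.arc 3)) → (∀ z, Metric.infDist z (R.arc 0) ≤ δ → δ < Metric.infDist z (R.arc 2)) → (∀ t, ∀ v : (ℤ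 × ℤ) ⊕ (ℤ × ℤ), dist (γ t) ((δ : ℂ) * zGs v) ≤ δ / 2 → (δ : ℂ) * zGs v ∈ blackRegion ((s : ℂ) • (c.1 : Set ℂ)) ((s : ℂ) • (c.2 : Set ℂ))) → blockConfig δ s c ∈ crudeCrossing R δ :=
  fun R _ hδ s c _ _ γ _ _ hF₀ hF₂ hdisj hout h₀ h₂ hx hy h1 h3 h02 hblack =>
    blockConfig_mem_crudeCrossing_of_split_path R hδ s c γ hF₀ hF₂ hdisj hout h₀ h₂ hx hy h1 h3 h02 hblack

/-- **Registered sub-goal `stub_faithful_part2`** of `stub_faithful` (K1): a ROBUSTLY black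
continuum path (all sites of `δ • G_s` within `δ/2` of it are black) from within `δ` of `(ab)` to
within `δ` of `(cd)`, at distance `> δ` from `(bc)`, `(da)`, unable to make that passage off
`closure Ω`, gives the crude block crossing of `R` at mesh `δ` (`2δ` slack = `δ` to exit the
collar of `∂Ω` + `δ/2` covering radius), for EVERY conformal rectangle. [folklore] -/
theorem stub_faithful_part2 : ∀ (R : ConformalRectangle) {δ : ℝ}, 0 < δ → ∀ (s : ℝ) (c : PointConfig ℂ × PointConfig ℂ) {x y : ℂ} (γ : Path x y), Metric.infDist x (R.arc 0) ≤ δ → (∃ t, Metric.infDist (γ t) (R.arc 2) ≤ δ) → (∀ t₁ t₂ : unitInterval, t₁ ≤ t₂ → Metric.infDist (γ t₁) (R.arc 0) ≤ δ → Metric.infDist (γ t₂) (R.arc 2) ≤ δ → ∃ u : unitInterval, t₁ ≤ u ∧ u ≤ t₂ ∧ γ u ∈ closure R.carrier) → (∀ t, δ < Metric.infDist (γ t) (R.arc 1)) → (∀ t, δ < Metric.infDist (γ t) (R.arc 3)) → (∀ z, Metric.infDist z (R.arc 0) ≤ δ → δ < Metric.infDist z (R.arc 2)) → (∀ t, ∀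 v : (ℤ × ℤ) ⊕ (ℤ × ℤ), dist (γ t) ((δ : ℂ) * zGs v) ≤ δ / 2 → (δ : ℂ) * zGs v ∈ blackRegion ((s : ℂ) • (c.1 : Set ℂ)) ((s : ℂ) • (c.2 : Set ℂ))) → blockConfig δ s c ∈ crudeCrossing R δ :=
  fun R _ hδ s c _ _ γ hx hy hcl h1 h3 h02 hblack =>
    blockConfig_mem_crudeCrossing_of_robust_path R hδ s c γ hx hy hcl h1 h3 h02 hblack

end Summit.CriticalPhenomena.CardyFormulaZ2.Cruxes.SquareFromVoronoiHub.VoronoiBlocks.Faithful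

end
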